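import Mathlib
import HarnessLib
import Summits.ResolutionOfSingularities.ResolutionOfSingularities.Theorems.WildQuotientsWildQuotientResolutionTwoBlocksCentreStable
import Summits.ResolutionOfSingularities.ResolutionOfSingularities.Theorems.WildQuotientsWildQuotientResolutionToricExitChartStable
import Literature.AlgebraicGeometry.Resolution.AffineBlowupIntegral
import Literature.AlgebraicGeometry.Resolution.BlowupPrincipalCharts
import Literature.AlgebraicGeometry.Resolution.BlowupsEquivariant

/-!
# N4a frame (`𝔸ⁿ/(J₃ ⊕ J₂)`, every `p`): the `σ`-stable centre `I = (x_a, x_b², x_bx_d, x_d²)`,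
# its blow-up `V = Bl_I 𝔸ⁿ`, the cover `V = V[x_a] ∪ V[x_b²] ∪ V[x_d²]`, stability of `V[x_a]`, `V[x_d²]`

(crux stmt-ResolutionOfSingularities-15640 `WildQuotients.WildQuotientResolution`, line `Sketch`;
chain w45c post-V5 width target N4a `JordanThreeTwo.jordanThreeTwo_hasResolution`
(res-L1-w45c-stub-2 SIG 2026-08-27T14:24:14Z, res-L1-w45c-plan-1 NO OBJECTION 14:24:34Z and
15:17:58Z «stub-2 g5 = N4a PART F»), part (F0) of res-L1-w45c-stub-2's file plan 15:17:44Z; the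
`J₃ ⊕ J₂` twin of `…ToricExitCentre` (p485686). [OURS · L1 W4.5c] — NOT a statement of any
manuscript; replaces the role of no printed item. Def-free: the centre is spelt
`Ideal.span (Set.range ![X a, X b ^ 2, X b * X d, X d ^ 2])` (res-L1-w45c-plan-1 15:17:58Z
«centre spelling of record»).)

The `J₃ ⊕ J₂` datum on `k[x₁,…,xₙ]`: `σ x_b = x_b + x_a`, `σ x_c = x_c + x_b`, `σ x_e = x_e + x_d`,
every other variable (in particular `x_a`, `x_d`) fixed. The centre of the first floor is the
`(2,1,1)`-weighted ideal `I = (x_a, x_b², x_b x_d, x_d²)` of the fixed subspace `V(x_a, x_b, x_d)`.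

* `map_I4_le`, `map_I4_eq`, `smul_I4_pointwise`, `idealSheaf_I4_comap` — `I` is `⟨σ⟩`-stable in
  EVERY characteristic (`τ(x_b²) = x_b² + x_a(2s x_b + s² x_a)`, `τ(x_bx_d) = x_bx_d + s x_a x_d` for
  `τ x_b = x_b + s x_a`, and `x_a ∈ I`); `idealSheaf_I4_comap` is VERBATIM the hypothesis `hJ` of
  `IsBlowup.liftAction` for `V = Bl_I 𝔸ⁿ` and any `ρ` with the affine-quotient law.
* `I4_ne_bot`, `I4_blowup_integral_proper_birational` — `Bl_I 𝔸ⁿ` is integral, proper and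
  birational over `𝔸ⁿ`.
* `smul_X_a_eq`, `smul_X_d_sq_eq` — `g • x_a = x_a`, `g • x_d² = x_d²` (`g ∈ ⟨σ⟩`): the generators of
  the charts `V[x_a]` (cone piece) and `V[x_d²]` (second K–L piece) are invariant, so these two
  principal charts are `G`-stable (`preimage_chart_a_eq`, `preimage_chart_dsq_eq`, via
  `ToricExit.preimage_blowupChart_eq_self_of_action`).
* `isPrincipalChart_of_sq_eq_mul` (generic) and `chart_bd_le_chart_bsq` — a principal chart for
  `x_bx_d` is one for `x_b²` (`(x_bx_d)² = x_b² · x_d²` and `π^*(x_bx_d)` is a nonzerodivisor force the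
  cofactor of `x_b²` to be a unit), hence **`iSup_chart_three_eq_top`: `V[x_a] ⊔ V[x_b²] ⊔ V[x_d²] = V`**.
-/

-- single-problem summit: the doubled namespace component `ResolutionOfSingularities` is forced
set_option linter.dupNamespace false

noncomputable section

open CategoryTheory AlgebraicGeometry TopologicalSpace MvPolynomial
open scoped Pointwise
open Literature.AlgebraicGeometry.Resolution

namespace Summit.ResolutionOfSingularities.ResolutionOfSingularities.Theorems.WildQuotientResolution.JordanThreeTwo

section Algebra

variable (k : Type) [Field k] (n : ℕ)

/-- **`τ(I) ⊆ I`**, `I = (x_a, x_b², x_bx_d, x_d²)`, for every ring endomorphism `τ` of `k[x]` with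
`τ x_a = x_a`, `τ x_b = x_b + s·x_a`, `τ x_d = x_d` (`s` arbitrary; any characteristic). [folklore] -/
theorem map_I4_le (a b d : Fin n) (τ : MvPolynomial (Fin n) k →+* MvPolynomial (Fin n) k)
    (s : MvPolynomial (Fin n) k) (ha : τ (X a) = X a) (hb : τ (X b) = X b + s * X a)
    (hd : τ (X d) = X d) :
    Ideal.map τ (Ideal.span (Set.range (![X a, X b ^ 2, X b * X d, X d ^ 2] :
        Fin 4 → MvPolynomial (Fin n) k))) ≤
      Ideal.span (Set.range (![X a, X b ^ 2, X b * X d, X d ^ 2] :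
        Fin 4 → MvPolynomial (Fin n) k)) := by
  rw [Ideal.map_span, Ideal.span_le]
  rintro _ ⟨_, ⟨j, rfl⟩, rfl⟩
  rw [SetLike.mem_coe, Ideal.mem_span_range_iff_exists_fun]
  fin_cases j
  · refine ⟨![1, 0, 0, 0], ?_⟩
    simp only [Fin.sum_univ_four, Matrix.cons_val_zero, Matrix.cons_val_one, Matrix.cons_val,
      Fin.zero_eta, ha]
    ring
  · refine ⟨![2 * s * X b + s ^ 2 * X a, 1, 0, 0], ?_⟩
    simp only [Fin.sum_univ_four, Matrix.cons_val_zero, Matrix.cons_val_one, Matrix.cons_val,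
      Fin.mk_one, map_pow, hb]
    ring
  · refine ⟨![s * X d, 0, 1, 0], ?_⟩
    simp only [Fin.sum_univ_four, Matrix.cons_val_zero, Matrix.cons_val_one, Matrix.cons_val,
      Fin.reduceFinMk, map_mul, hb, hd]
    ring
  · refine ⟨![0, 0, 0, 1], ?_⟩
    simp only [Fin.sum_univ_four, Matrix.cons_val_zero, Matrix.cons_val_one, Matrix.cons_val,
      Fin.reduceFinMk, map_pow, hd]
    ring

/-- **`σ(I) = I`** for the `J₃ ⊕ J₂` datum (`map_I4_le` for `σ` with `s = 1` and for `σ⁻¹` with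
`s = −1`). [folklore] -/
theorem map_I4_eq (σ : MvPolynomial (Fin n) k ≃ₐ[k] MvPolynomial (Fin n) k) (a b d : Fin n)
    (ha : σ (X a) = X a) (hb : σ (X b) = X b + X a) (hd : σ (X d) = X d) :
    Ideal.map (σ : MvPolynomial (Fin n) k →+* MvPolynomial (Fin n) k)
      (Ideal.span (Set.range (![X a, X b ^ 2, X b * X d, X d ^ 2] :
        Fin 4 → MvPolynomial (Fin n) k))) =
      Ideal.span (Set.range (![X a, X b ^ 2, X b * X d, X d ^ 2] :
        Fin 4 → MvPolynomial (Fin n) k)) := by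
  apply le_antisymm
  · exact map_I4_le k n a b d (σ : MvPolynomial (Fin n) k →+* MvPolynomial (Fin n) k) 1
      (by simpa only [RingHom.coe_coe] using ha) (by simpa only [RingHom.coe_coe, one_mul] using hb)
      (by simpa only [RingHom.coe_coe] using hd)
  · have ha' : σ.symm (X a) = X a := by
      conv_lhs => rw [← ha]
      exact σ.symm_apply_apply _
    have hd' : σ.symm (X d) = X d := by
      conv_lhs => rw [← hd]
      exact σ.symm_apply_apply _
    have hb' : σ.symm (X b) = X b + (-1) * X a := by
      have h := σ.symm_apply_apply (X b)
      rw [hb, map_add, ha'] at h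
      linear_combination h
    have hle := map_I4_le k n a b d (σ.symm : MvPolynomial (Fin n) k →+* MvPolynomial (Fin n) k)
      (-1) (by simpa only [RingHom.coe_coe] using ha') (by simpa only [RingHom.coe_coe] using hb')
      (by simpa only [RingHom.coe_coe] using hd')
    have hcomp : (σ : MvPolynomial (Fin n) k →+* MvPolynomial (Fin n) k).comp
        (σ.symm : MvPolynomial (Fin n) k →+* MvPolynomial (Fin n) k) = RingHom.id _ := by
      ext x <;> simp
    calc Ideal.span (Set.range (![X a, X b ^ 2, X b * X d, X d ^ 2] :
          Fin 4 → MvPolynomial (Fin n) k))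
        = Ideal.map ((σ : MvPolynomial (Fin n) k →+* MvPolynomial (Fin n) k).comp
            (σ.symm : MvPolynomial (Fin n) k →+* MvPolynomial (Fin n) k))
            (Ideal.span (Set.range (![X a, X b ^ 2, X b * X d, X d ^ 2] :
              Fin 4 → MvPolynomial (Fin n) k))) := by
          rw [hcomp, Ideal.map_id]
      _ = Ideal.map (σ : MvPolynomial (Fin n) k →+* MvPolynomial (Fin n) k)
            (Ideal.map (σ.symm : MvPolynomial (Fin n) k →+* MvPolynomial (Fin n) k)
              (Ideal.span (Set.range (![X a, X b ^ 2, X b * X d, X d ^ 2] :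
                Fin 4 → MvPolynomial (Fin n) k)))) := by
          rw [Ideal.map_map]
      _ ≤ _ := Ideal.map_mono hle

variable (σ : MvPolynomial (Fin n) k ≃ₐ[k] MvPolynomial (Fin n) k) (a b c d e : Fin n)
  (hab : a ≠ b) (hac : a ≠ c) (hae : a ≠ e) (hbd : b ≠ d) (hcd : c ≠ d) (hde : d ≠ e)
  (hb : σ (X b) = X b + X a) (hσ : ∀ i, i ≠ b → i ≠ c → i ≠ e → σ (X i) = X i)

include hab hac hae hσ in
/-- `g • x_a = x_a` for every `g ∈ ⟨σ⟩` (`σ x_a = x_a`). [folklore] -/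
theorem smul_X_a_eq (g : Subgroup.zpowers σ) : g • (X a : MvPolynomial (Fin n) k) = X a := by
  have ha : σ • (X a : MvPolynomial (Fin n) k) = X a := hσ a hab hac hae
  obtain ⟨z, hz⟩ := Subgroup.mem_zpowers_iff.mp g.2
  change (g : MvPolynomial (Fin n) k ≃ₐ[k] MvPolynomial (Fin n) k) • (X a : MvPolynomial (Fin n) k) = _
  rw [← hz]
  exact MulAction.fixedBy_subset_fixedBy_zpow (MvPolynomial (Fin n) k) σ z ha

include hbd hcd hde hσ in
/-- `g • x_d² = x_d²` for every `g ∈ ⟨σ⟩` (`σ x_d = x_d`). [folklore] -/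
theorem smul_X_d_sq_eq (g : Subgroup.zpowers σ) :
    g • (X d ^ 2 : MvPolynomial (Fin n) k) = X d ^ 2 := by
  have hd : σ • (X d ^ 2 : MvPolynomial (Fin n) k) = X d ^ 2 := by
    change σ (X d ^ 2) = X d ^ 2
    rw [map_pow, hσ d (Ne.symm hbd) (Ne.symm hcd) hde]
  obtain ⟨z, hz⟩ := Subgroup.mem_zpowers_iff.mp g.2
  change (g : MvPolynomial (Fin n) k ≃ₐ[k] MvPolynomial (Fin n) k) •
    (X d ^ 2 : MvPolynomial (Fin n) k) = _
  rw [← hz]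
  exact MulAction.fixedBy_subset_fixedBy_zpow (MvPolynomial (Fin n) k) σ z hd

include hab hac hae hbd hcd hde hb hσ in
/-- **`I = (x_a, x_b², x_bx_d, x_d²)` is `⟨σ⟩`-stable**: `g • I = I` for every `g ∈ ⟨σ⟩`, in EVERY
characteristic — the hypothesis of `AffineQuotient.idealSheaf_comap_specAction`. [folklore] -/
theorem smul_I4_pointwise (g : Subgroup.zpowers σ) :
    g • Ideal.span (Set.range (![X a, X b ^ 2, X b * X d, X d ^ 2] :
        Fin 4 → MvPolynomial (Fin n) k)) =
      Ideal.span (Set.range (![X a, X b ^ 2, X b * X d, X d ^ 2] :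
        Fin 4 → MvPolynomial (Fin n) k)) := by
  have ha : σ (X a) = X a := hσ a hab hac hae
  have hd : σ (X d) = X d := hσ d (Ne.symm hbd) (Ne.symm hcd) hde
  have hσ' : σ • Ideal.span (Set.range (![X a, X b ^ 2, X b * X d, X d ^ 2] :
        Fin 4 → MvPolynomial (Fin n) k)) =
      Ideal.span (Set.range (![X a, X b ^ 2, X b * X d, X d ^ 2] :
        Fin 4 → MvPolynomial (Fin n) k)) :=
    map_I4_eq k n σ a b d ha hb hd
  obtain ⟨z, hz⟩ := Subgroup.mem_zpowers_iff.mp g.2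
  change (g : MvPolynomial (Fin n) k ≃ₐ[k] MvPolynomial (Fin n) k) •
      Ideal.span (Set.range (![X a, X b ^ 2, X b * X d, X d ^ 2] :
        Fin 4 → MvPolynomial (Fin n) k)) = _
  rw [← hz]
  exact MulAction.fixedBy_subset_fixedBy_zpow (Ideal (MvPolynomial (Fin n) k)) σ z hσ'

include hab hac hae hbd hcd hde hb hσ in
/-- **The ideal sheaf of `I = (x_a, x_b², x_bx_d, x_d²)` on `𝔸ⁿ` is stable under the action of
`⟨σ⟩`** (`ρ g = Spec (g⁻¹)`) — VERBATIM the hypothesis `hJ` of `IsBlowup.liftAction` for the N4a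
model `Bl_I 𝔸ⁿ`, every characteristic. [folklore] -/
theorem idealSheaf_I4_comap
    (ρ : ↥(Subgroup.zpowers σ) →* Aut (Spec (CommRingCat.of (MvPolynomial (Fin n) k))))
    (hρ : ∀ g : ↥(Subgroup.zpowers σ), (ρ g).hom = Spec.map (CommRingCat.ofHom
      ((MulSemiringAction.toRingEquiv (↥(Subgroup.zpowers σ)) (MvPolynomial (Fin n) k) g⁻¹ :
        MvPolynomial (Fin n) k ≃+* MvPolynomial (Fin n) k) :
          MvPolynomial (Fin n) k →+* MvPolynomial (Fin n) k)))
    (g : ↥(Subgroup.zpowers σ)) :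
    (affineBlowup.idealSheaf (Ideal.span (Set.range (![X a, X b ^ 2, X b * X d, X d ^ 2] :
        Fin 4 → MvPolynomial (Fin n) k)))).comap (ρ g).hom =
      affineBlowup.idealSheaf (Ideal.span (Set.range (![X a, X b ^ 2, X b * X d, X d ^ 2] :
        Fin 4 → MvPolynomial (Fin n) k))) :=
  AffineQuotient.idealSheaf_comap_specAction ρ hρ _
    (smul_I4_pointwise k n σ a b c d e hab hac hae hbd hcd hde hb hσ) g

/-- `I ≠ 0` (`x_a ∈ I`). [folklore] -/
theorem I4_ne_bot (a b d : Fin n) :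
    Ideal.span (Set.range (![X a, X b ^ 2, X b * X d, X d ^ 2] :
      Fin 4 → MvPolynomial (Fin n) k)) ≠ ⊥ := by
  intro h
  have hx : (X a : MvPolynomial (Fin n) k) ∈
      Ideal.span (Set.range (![X a, X b ^ 2, X b * X d, X d ^ 2] :
        Fin 4 → MvPolynomial (Fin n) k)) :=
    Ideal.subset_span ⟨0, rfl⟩
  rw [h, Ideal.mem_bot] at hx
  exact X_ne_zero a hx

/-- **`Bl_I 𝔸ⁿ` is integral, and `Bl_I 𝔸ⁿ → 𝔸ⁿ` is proper and birational** (`I ≠ 0` in a domain).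
[cite: StacksProject, Tag 02OS] -/
theorem I4_blowup_integral_proper_birational (a b d : Fin n) :
    IsIntegral (affineBlowup (Ideal.span (Set.range (![X a, X b ^ 2, X b * X d, X d ^ 2] :
        Fin 4 → MvPolynomial (Fin n) k)))) ∧
      IsProper (affineBlowup.π (Ideal.span (Set.range (![X a, X b ^ 2, X b * X d, X d ^ 2] :
        Fin 4 → MvPolynomial (Fin n) k)))) ∧
      IsBirational (affineBlowup.π (Ideal.span (Set.range (![X a, X b ^ 2, X b * X d, X d ^ 2] :
        Fin 4 → MvPolynomial (Fin n) k)))) :=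
  ⟨affineBlowup.isIntegral (I4_ne_bot k n a b d), inferInstance,
    affineBlowup.isBirational (I4_ne_bot k n a b d)⟩

end Algebra

/-! ## Principal charts: a chart for `x_bx_d` is a chart for `x_b²`; the three-chart cover -/

section Charts

universe u

/-- **Transfer of principal charts along `g² = s·s'`**: if the affine open `W` is a principal
chart for `(U, g)` and `g * g = s * s'` with `s, s' ∈ I(U)`, then `W` is a principal chart for
`(U, s)`: on `W`, `π^*s = α·π^*g`, `π^*s' = β·π^*g`, so `π^*g² = αβ·π^*g²` and `αβ = 1` since `π^*g`
is a nonzerodivisor — `α` is a unit. [folklore] -/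
theorem isPrincipalChart_of_sq_eq_mul {X' X : Scheme.{u}} {π : X' ⟶ X} {I : X.IdealSheafData}
    {U : X.affineOpens} {g s s' : Γ(X, U)} (hs : s ∈ I.ideal U) (hs' : s' ∈ I.ideal U)
    (hg : g * g = s * s') {W : X'.affineOpens} (hW : IsPrincipalChart π I U g W) :
    IsPrincipalChart π I U s W := by
  obtain ⟨α, hα⟩ := hW.exists_eq_mul hs
  obtain ⟨β, hβ⟩ := hW.exists_eq_mul hs'
  obtain ⟨h, hnzd, hideal⟩ := hW
  have hle : (W : X'.Opens) ≤ π ⁻¹ᵁ (U : X.Opens) := h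
  -- `αβ = 1`
  have hprod : π.appLE U W hle g * π.appLE U W hle g =
      α * π.appLE U W hle g * (β * π.appLE U W hle g) := by
    have := congrArg (π.appLE U W hle) hg
    rwa [map_mul, map_mul, hα, hβ] at this
  have hgg : π.appLE U W hle g * π.appLE U W hle g ∈ nonZeroDivisors Γ(X', W) := mul_mem hnzd hnzd
  have hunit : α * β = 1 := by
    have h1 : (α * β - 1) * (π.appLE U W hle g * π.appLE U W hle g) = 0 := by
      linear_combination (-1 : Γ(X', W)) * hprod
    have h2 := (hgg.2 _ h1 : α * β - 1 = 0)
    linear_combination h2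
  have hαu : IsUnit α := IsUnit.of_mul_eq_one β hunit
  refine ⟨hle, ?_, ?_⟩
  · rw [hα]
    exact mul_mem (hαu.mem_nonZeroDivisors) hnzd
  · rw [hideal, hα]
    exact (Ideal.span_singleton_mul_left_unit hαu _).symm

/-- Hence **`X'[U, g] ≤ X'[U, s]`** whenever `g * g = s * s'` with `s, s' ∈ I(U)`. [folklore] -/
theorem blowupChart_le_of_sq_eq_mul {X' X : Scheme.{u}} {π : X' ⟶ X} {I : X.IdealSheafData}
    {U : X.affineOpens} {g s s' : Γ(X, U)} (hs : s ∈ I.ideal U) (hs' : s' ∈ I.ideal U)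
    (hg : g * g = s * s') : blowupChart π I U g ≤ blowupChart π I U s := by
  intro x hx
  obtain ⟨W, hW, hxW⟩ := mem_blowupChart_iff.mp hx
  exact mem_blowupChart_iff.mpr ⟨W, isPrincipalChart_of_sq_eq_mul hs hs' hg hW, hxW⟩

variable (k : Type) [Field k] (n : ℕ) (a b d : Fin n)

/-- The generator vector of record (local shorthand). -/
local notation3 "g4" => (![X a, X b ^ 2, X b * X d, X d ^ 2] : Fin 4 → MvPolynomial (Fin n) k)
/-- The centre `I = (x_a, x_b², x_bx_d, x_d²)` (local shorthand). -/
local notation3 "I4" => Ideal.span (Set.range g4)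
/-- `k[x] → Γ(Spec k[x], ⊤)` (local shorthand). -/
local notation3 "ι₀" => (Scheme.ΓSpecIso (CommRingCat.of (MvPolynomial (Fin n) k))).inv.hom
/-- The principal chart `V[gens j]` of `V = Bl_I 𝔸ⁿ` (local shorthand). -/
local notation3 "Vch" => fun j : Fin 4 => blowupChart (affineBlowup.π I4) (affineBlowup.idealSheaf I4)
  ⟨⊤, isAffineOpen_top _⟩ (ι₀ (g4 j))

/-- The ideal of the centre's ideal sheaf over `⊤` is the image of `I`. [folklore] -/
theorem idealSheaf_I4_ideal_top :
    (affineBlowup.idealSheaf I4).ideal ⟨⊤, isAffineOpen_top _⟩ = Ideal.map ι₀ I4 := by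
  change (Scheme.IdealSheafData.ofIdealTop _).ideal ⟨⊤, isAffineOpen_top _⟩ = _
  rw [ideal_ofIdealTop_top]

/-- The sections `ι₀ (gens j)` lie in the ideal of the centre over `⊤`. [folklore] -/
theorem ι_gens_mem_ideal_top (j : Fin 4) :
    ι₀ (g4 j) ∈ (affineBlowup.idealSheaf I4).ideal ⟨⊤, isAffineOpen_top _⟩ := by
  rw [idealSheaf_I4_ideal_top]
  exact Ideal.mem_map_of_mem _ (Ideal.subset_span ⟨j, rfl⟩)

/-- **`V[x_bx_d] ≤ V[x_b²]`** on `V = Bl_I 𝔸ⁿ` (`(x_bx_d)² = x_b² · x_d²`). [folklore] -/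
theorem chart_bd_le_chart_bsq : Vch 2 ≤ Vch 1 :=
  blowupChart_le_of_sq_eq_mul (ι_gens_mem_ideal_top k n a b d 1) (ι_gens_mem_ideal_top k n a b d 3)
    (by
      change ι₀ (X b * X d) * ι₀ (X b * X d) = ι₀ (X b ^ 2) * ι₀ (X d ^ 2)
      rw [← map_mul, ← map_mul]
      congr 1
      ring)

/-- **The three-chart cover `V[x_a] ⊔ V[x_b²] ⊔ V[x_d²] = V`** of `V = Bl_I 𝔸ⁿ`,
`I = (x_a, x_b², x_bx_d, x_d²)` (the four principal charts cover by `IsBlowup.iSup_blowupChart`, and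
`V[x_bx_d] ≤ V[x_b²]`). [folklore] -/
theorem chart_a_sup_chart_bsq_sup_chart_dsq_eq_top : Vch 0 ⊔ Vch 1 ⊔ Vch 3 = ⊤ := by
  have hπ : IsBlowup (affineBlowup.π I4) (affineBlowup.idealSheaf I4) := affineBlowup.isBlowup I4
  have hx : Ideal.span (Set.range (fun j : Fin 4 => ι₀ (g4 j))) =
      (affineBlowup.idealSheaf I4).ideal ⟨⊤, isAffineOpen_top _⟩ := by
    rw [idealSheaf_I4_ideal_top, Ideal.map_span, ← Set.range_comp]
    rfl
  have h := hπ.iSup_blowupChart (U := ⟨⊤, isAffineOpen_top _⟩) (fun j : Fin 4 => ι₀ (g4 j)) hx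
  rw [Scheme.Hom.preimage_top] at h
  rw [eq_top_iff, ← h]
  refine iSup_le fun j => ?_
  fin_cases j
  · exact le_sup_left.trans le_sup_left
  · exact le_sup_right.trans le_sup_left
  · exact ((chart_bd_le_chart_bsq k n a b d).trans le_sup_right).trans le_sup_left
  · exact le_sup_right

variable (σ : MvPolynomial (Fin n) k ≃ₐ[k] MvPolynomial (Fin n) k) (c e : Fin n)
  (hab : a ≠ b) (hac : a ≠ c) (hae : a ≠ e) (hbd : b ≠ d) (hcd : c ≠ d) (hde : d ≠ e)
  (hb : σ (X b) = X b + X a) (hσ : ∀ i, i ≠ b → i ≠ c → i ≠ e → σ (X i) = X i)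
  (ρ : ↥(Subgroup.zpowers σ) →* Aut (Spec (CommRingCat.of (MvPolynomial (Fin n) k))))
  (hρ : ∀ g : ↥(Subgroup.zpowers σ), (ρ g).hom = Spec.map (CommRingCat.ofHom
    ((MulSemiringAction.toRingEquiv (↥(Subgroup.zpowers σ)) (MvPolynomial (Fin n) k) g⁻¹ :
      MvPolynomial (Fin n) k ≃+* MvPolynomial (Fin n) k) :
        MvPolynomial (Fin n) k →+* MvPolynomial (Fin n) k)))
  (hJ : ∀ g : ↥(Subgroup.zpowers σ), (affineBlowup.idealSheaf I4).comap (ρ g).hom =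
    affineBlowup.idealSheaf I4)

include hab hac hae hσ hρ in
/-- **The cone chart `V[x_a]` is `G`-stable** under the lifted action (`σ x_a = x_a`). [folklore] -/
theorem preimage_chart_a_eq (g : ↥(Subgroup.zpowers σ)) :
    (((affineBlowup.isBlowup I4).liftAction ρ hJ) g).hom ⁻¹ᵁ Vch 0 = Vch 0 :=
  ToricExit.preimage_blowupChart_eq_self_of_action (affineBlowup.isBlowup I4) ρ
    ((affineBlowup.isBlowup I4).liftAction ρ hJ)
    (fun g => (affineBlowup.isBlowup I4).liftAction_hom_comp ρ hJ g) hJ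
    (ι_gens_mem_ideal_top k n a b d 0)
    (fun g => ToricExit.specAction_appTop_ΓSpecIso_inv ρ hρ (X a)
      (smul_X_a_eq k n σ a b c e hab hac hae hσ) g) g

include hbd hcd hde hσ hρ in
/-- **The K–L chart `V[x_d²]` is `G`-stable** under the lifted action (`σ x_d = x_d`). [folklore] -/
theorem preimage_chart_dsq_eq (g : ↥(Subgroup.zpowers σ)) :
    (((affineBlowup.isBlowup I4).liftAction ρ hJ) g).hom ⁻¹ᵁ Vch 3 = Vch 3 :=
  ToricExit.preimage_blowupChart_eq_self_of_action (affineBlowup.isBlowup I4) ρ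
    ((affineBlowup.isBlowup I4).liftAction ρ hJ)
    (fun g => (affineBlowup.isBlowup I4).liftAction_hom_comp ρ hJ g) hJ
    (ι_gens_mem_ideal_top k n a b d 3)
    (fun g => ToricExit.specAction_appTop_ΓSpecIso_inv ρ hρ (X d ^ 2)
      (smul_X_d_sq_eq k n σ b c d e hbd hcd hde hσ) g) g

end Charts

end Summit.ResolutionOfSingularities.ResolutionOfSingularities.Theorems.WildQuotientResolution.JordanThreeTwo

end
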